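import Mathlib
import Literature.Geometry.Lorentzian.Stationary
import Literature.Geometry.Lorentzian.Einstein
import Literature.Geometry.Lorentzian.Causality
import Literature.Geometry.Lorentzian.IPlusRegular
import Literature.Geometry.Lorentzian.KillingHorizonShadowAlong

/-!
# Crux `HawkingExtensionIsKerr` (stmt-FinalStateConjecture-17840) — ideator 2, round 1: first lemmas

Statements only (they must elaborate; no claim of proof), for the two crux idea cards

* `horizon-anchored-causal-sandwich` : `CollarSandwich`, `KillingSandwichCompleteness`,
  `DocAxisymmetryFromExtension` (line target, doc level);
* `degenerate-horizon-gauss-bonnet`  : `DegenerateGeneratorTurnsSpacelike` (the lever, contrapositive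
  form), `CollarSurfaceGravityNeZero` (line target).

All are typed over the tree vocabulary of the crux decl itself (`StationaryAFBlackHole`, `doc`,
`horizon`, `killing`, `metric.val`, `metric.leviCivita`, `IsMIntegralCurve`, `stationaryOrbit`,
`IsGloballyHyperbolicSet`, `chronologicalFuture/Past`, `causalFuture/Past`, `IsKillingFieldOn`).
-/

noncomputable section

set_option linter.dupNamespace false

namespace Summit.FinalStateConjecture.FinalStateConjecture.Cruxes.HawkingExtensionIsKerr.SketchIdeator2

open Set Function Literature.Geometry.Lorentzian
open scoped Manifold Topology

/-! ## Card `horizon-anchored-causal-sandwich` -/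

/-- **First lemma (A1, provable now, size M): collar points sandwich the d.o.c. causally.**
For ANY non-empty `T`-invariant subset `N ⊆ doc` (meant: one Killing–timelike collar level set
`N_ε = {g(K,K) = −ε}` next to `𝓔⁺`, which is `T`-invariant because `[T, K] = 0`), every point of
the d.o.c. lies in the chronological future of some point of `N` and in the chronological past of
another.  Proof route: `doc = I⁺(M_ext) ∩ I⁻(M_ext)`, `I^±(M_ext) = I^±(T·y)` for every
`y ∈ M_ext` (tree: `chronologicalFuture_eq_of_invariant`, `chronologicalPast_eq_of_invariant`,
StubFuturePresentationPieces), and flow-invariance of `≪` under the complete Killing flow of `T`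
(tree: `IsKillingField.image_flow_chronologicalFuture`). -/
def CollarSandwich : Prop :=
  ∀ (𝓑 : StationaryAFBlackHole.{0}) [𝓑.metric.HasLeviCivita] (N : Set 𝓑.carrier),
    N ⊆ 𝓑.doc → N.Nonempty →
    (∀ δ : ℝ → 𝓑.carrier, IsMIntegralCurve δ 𝓑.killing → δ 0 ∈ N → ∀ s, δ s ∈ N) →
    ∀ p ∈ 𝓑.doc, ∃ q₁ ∈ N, ∃ q₂ ∈ N,
      p ∈ 𝓑.metric.chronologicalFuture 𝓑.timeOrientation {q₁} ∧
      p ∈ 𝓑.metric.chronologicalPast 𝓑.timeOrientation {q₂}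

/-- **The lever (A2): Chruściel's causal sandwich, run from anchors inside the d.o.c.**
Let `doc` be a globally hyperbolic set (part of `IsIPlusRegular`), `Z` a Killing field on `doc`,
and `C₁, C₂ ⊆ doc` compact sets each carrying COMPLETE `Z`-orbits (meant: the two closed
`Z`-circles through the collar anchors `q₁ ≪ p ≪ q₂` of `CollarSandwich`).  Then the `Z`-orbit of
every `p ∈ J⁺(C₁) ∩ J⁻(C₂) ∩ doc` is complete and stays in `doc`: as long as it exists it is
confined to the compact diamond `J⁺(C₁) ∩ J⁻(C₂) ⊆ doc`, because the (local) Killing flow maps the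
causal curve `q₁ → p → q₂` to a causal curve between points of `C₁` and `C₂`
(Chruściel, CMP 189 (1997) 1, proof of Thm 1.1 — there with anchors at infinity). -/
def KillingSandwichCompleteness : Prop :=
  ∀ (𝓑 : StationaryAFBlackHole.{0}) [𝓑.metric.HasLeviCivita],
    𝓑.metric.IsGloballyHyperbolicSet 𝓑.timeOrientation 𝓑.doc →
    ∀ (Z : Π x : 𝓑.carrier, TangentSpace (𝓡 4) x),
      𝓑.metric.toPseudoRiemannianMetric.IsKillingFieldOn Z 𝓑.doc →
      ∀ (C₁ C₂ : Set 𝓑.carrier), IsCompact C₁ → IsCompact C₂ → C₁ ⊆ 𝓑.doc → C₂ ⊆ 𝓑.doc →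
        (∀ x ∈ C₁, ∃ γ : ℝ → 𝓑.carrier, IsMIntegralCurve γ Z ∧ γ 0 = x ∧ ∀ t, γ t ∈ C₁) →
        (∀ x ∈ C₂, ∃ γ : ℝ → 𝓑.carrier, IsMIntegralCurve γ Z ∧ γ 0 = x ∧ ∀ t, γ t ∈ C₂) →
        ∀ p ∈ 𝓑.doc, p ∈ 𝓑.metric.causalFuture 𝓑.timeOrientation C₁ →
          p ∈ 𝓑.metric.causalPast 𝓑.timeOrientation C₂ →
          ∃ γ : ℝ → 𝓑.carrier, IsMIntegralCurve γ Z ∧ γ 0 = p ∧ ∀ t, γ t ∈ 𝓑.doc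

/-- **Line target at d.o.c. level (A3): the telescope of `HawkingExtensionIsKerr`, conclusion
replaced by what the dock needs.**  Either the extension is a constant multiple of `T` on the
d.o.c. (non-rotating branch: Sudarsky–Wald + Chruściel–Galloway, both vendored), or there are a
Killing field `Φ` on the d.o.c. commuting with `T`, with COMPLETE `2π`-PERIODIC orbits inside the
d.o.c., non-trivial and with non-empty axis there, and constants `c ≠ 0`, `Ω` with
`K' = c • (T + Ω • Φ)` on the d.o.c. (rigid rotation of the hole).  Periodicity on one collar level
set comes from the compact isometry group of its Riemannian `K`-quotient (card
`periodicity-from-the-collar` on crux 10689, whose residue R is here a lemma of `IsIPlusRegular`),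
COMPLETENESS and periodicity on the whole d.o.c. from `CollarSandwich` + `KillingSandwichCompleteness`
+ rigidity of isometries. -/
def DocAxisymmetryFromExtension : Prop :=
  ∀ (𝓑 : Literature.Geometry.Lorentzian.StationaryAFBlackHole.{0}) [𝓑.metric.HasLeviCivita], 𝓑.metric.toPseudoRiemannianMetric.IsRicciFlat → 𝓑.IsIPlusRegular → (∀ p : 𝓑.carrier, p ∈ 𝓑.metric.chronologicalFuture 𝓑.timeOrientation 𝓑.Mext) → (∀ p ∈ 𝓑.doc, 𝓑.killing p ≠ 0) → SimplyConnectedSpace 𝓑.doc → ∀ (U : Set 𝓑.carrier) (K : Π x : 𝓑.carrier, TangentSpace (𝓡 4) x), IsOpen U → 𝓑.horizon ⊆ U → IsConnected 𝓑.horizon → ContMDiffOn (𝓡 4) ((𝓡 4).prod 𝓘(ℝ, Literature.Geometry.Lorentzian.E4)) ((⊤ : ℕ∞) : WithTop ℕ∞) (fun x ↦ (Bundle.TotalSpace.mk' Literature.Geometry.Lorentzian.E4 x (K x) : TangentBundle (𝓡 4) 𝓑.carrier)) U → (∀ x ∈ U, ∀ v w : TangentSpace (𝓡 4) x, 𝓑.metric.val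 x (𝓑.metric.leviCivita K x v) w + 𝓑.metric.val x v (𝓑.metric.leviCivita K x w) = 0) → (∀ x ∈ U, VectorField.mlieBracket (𝓡 4) 𝓑.killing K x = 0) → (∀ p ∈ 𝓑.horizon, K p ≠ 0) → (∀ γ : ℝ → 𝓑.carrier, IsMIntegralCurve γ K → γ 0 ∈ 𝓑.horizon → ∀ t, γ t ∈ 𝓑.horizon) → (∀ x ∈ U ∩ 𝓑.doc, 𝓑.metric.val x (K x) (K x) < 0) → (∃ K' : Π x : 𝓑.carrier, TangentSpace (𝓡 4) x, ContMDiffOn (𝓡 4) ((𝓡 4).prod 𝓘(ℝ, Literature.Geometry.Lorentzian.E4)) ((⊤ : ℕ∞) : WithTop ℕ∞) (fun x ↦ (Bundle.TotalSpace.mk' Literature.Geometry.Lorentzian.E4 x (K' x) : TangentBundle (𝓡 4) 𝓑.carrier)) 𝓑.doc ∧ (∀ x ∈ 𝓑.doc, ∀ v w : TangentSpace (𝓡 4) x, 𝓑.metric.val x (𝓑.metric.leviCivita K' x v) w + 𝓑.metric.val x v (𝓑.metric.leviCivita K' x w) = 0) ∧ (∀ x ∈ 𝓑.doc, VectorField.mlieBracket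 (𝓡 4) 𝓑.killing K' x = 0) ∧ ∃ U' : Set 𝓑.carrier, IsOpen U' ∧ 𝓑.horizon ⊆ U' ∧ ∀ x ∈ U' ∩ 𝓑.doc, K' x = K x) →
  ∀ (K' : Π x : 𝓑.carrier, TangentSpace (𝓡 4) x),
    𝓑.metric.toPseudoRiemannianMetric.IsKillingFieldOn K' 𝓑.doc →
    (∀ x ∈ 𝓑.doc, VectorField.mlieBracket (𝓡 4) 𝓑.killing K' x = 0) →
    (∃ U' : Set 𝓑.carrier, IsOpen U' ∧ 𝓑.horizon ⊆ U' ∧ ∀ x ∈ U' ∩ 𝓑.doc, K' x = K x) →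
    (∃ c : ℝ, ∀ x ∈ 𝓑.doc, K' x = c • 𝓑.killing x) ∨
    ∃ (Φ : Π x : 𝓑.carrier, TangentSpace (𝓡 4) x) (c Ω : ℝ), c ≠ 0 ∧
      𝓑.metric.toPseudoRiemannianMetric.IsKillingFieldOn Φ 𝓑.doc ∧
      (∀ x ∈ 𝓑.doc, VectorField.mlieBracket (𝓡 4) 𝓑.killing Φ x = 0) ∧
      (∀ x ∈ 𝓑.doc, ∃ γ : ℝ → 𝓑.carrier, IsMIntegralCurve γ Φ ∧ γ 0 = x ∧
        (∀ t, γ t ∈ 𝓑.doc) ∧ Function.Periodic γ (2 * Real.pi)) ∧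
      (∃ x ∈ 𝓑.doc, Φ x = 0) ∧ (∃ x ∈ 𝓑.doc, Φ x ≠ 0) ∧
      ∀ x ∈ 𝓑.doc, K' x = c • (𝓑.killing x + Ω • Φ x)

/-! ## Card `degenerate-horizon-gauss-bonnet` -/

/-- **The lever (B1), contrapositive and purely horizon-local form.**  For a vacuum, `I⁺`-regular
hole with connected horizon and simply connected d.o.c. (so the compact cross-sections of `𝓔⁺` are
spheres, Chruściel–Costa 2008 Cor. 4.6 / Chruściel–Wald 1994), let `K` be Killing on an open
`U ⊇ 𝓔⁺`, non-vanishing, null and TANGENT on `𝓔⁺`, with VANISHING surface gravity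
(`∇_K K = 0` on `𝓔⁺`: the degenerate case).  Then in every neighbourhood of `𝓔⁺` there are points
of the d.o.c. where `K` is SPACELIKE.  Mechanism: in Gaussian null coordinates `g(K,K) = r² F + O(r³)`
and the vacuum equations restricted to `𝓔⁺` give `F = R_γ + ½ div_γ h` on any cross-section
`(S, γ)` (Kunduri–Lucietti, Living Rev. Rel. 16 (2013) 8, eqs. for `R_{+-}` and the trace of the
horizon equation), hence `∫_S F dA_γ = 4π χ(S) = 8π > 0`. -/
def DegenerateGeneratorTurnsSpacelike : Prop :=
  ∀ (𝓑 : StationaryAFBlackHole.{0}) [𝓑.metric.HasLeviCivita],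
    𝓑.metric.toPseudoRiemannianMetric.IsRicciFlat → 𝓑.IsIPlusRegular →
    (∀ p : 𝓑.carrier, p ∈ 𝓑.metric.chronologicalFuture 𝓑.timeOrientation 𝓑.Mext) →
    IsConnected 𝓑.horizon → SimplyConnectedSpace 𝓑.doc →
    ∀ (U : Set 𝓑.carrier) (K : Π x : 𝓑.carrier, TangentSpace (𝓡 4) x), IsOpen U → 𝓑.horizon ⊆ U →
      𝓑.metric.toPseudoRiemannianMetric.IsKillingFieldOn K U →
      (∀ p ∈ 𝓑.horizon, K p ≠ 0) →
      (∀ p ∈ 𝓑.horizon, 𝓑.metric.val p (K p) (K p) = 0) →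
      (∀ γ : ℝ → 𝓑.carrier, IsMIntegralCurve γ K → γ 0 ∈ 𝓑.horizon → ∀ t, γ t ∈ 𝓑.horizon) →
      (∀ p ∈ 𝓑.horizon, 𝓑.metric.leviCivita K p (K p) = 0) →
      ∀ V : Set 𝓑.carrier, IsOpen V → 𝓑.horizon ⊆ V →
        ∃ x ∈ V ∩ 𝓑.doc, 0 < 𝓑.metric.val x (K x) (K x)

/-- **Line target (B2): the Killing–timelike collar has non-zero surface gravity.**  Telescope of
`HawkingExtensionIsKerr` up to and including the collar sign clause (the extension `K'` is not
needed) ⇒ `∃ κ ≠ 0, ∇_K K = κ • K` on `𝓔⁺` — the `κ`-clause of `IsNonDegenerateHorizon`, i.e. the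
input the landed endgame `RegularCase.stub_kerrConclusion_of_regular` (p89982) asks of its global
horizon Killing field.  Chain: `K` null and pregeodesic on `𝓔⁺` (collar sign + tangency +
achronality of `𝓔⁺`), `κ` constant on the connected `𝓔⁺` (vacuum zeroth law), `κ = 0` excluded by
`DegenerateGeneratorTurnsSpacelike` against the collar sign. -/
def CollarSurfaceGravityNeZero : Prop :=
  ∀ (𝓑 : Literature.Geometry.Lorentzian.StationaryAFBlackHole.{0}) [𝓑.metric.HasLeviCivita], 𝓑.metric.toPseudoRiemannianMetric.IsRicciFlat → 𝓑.IsIPlusRegular → (∀ p : 𝓑.carrier, p ∈ 𝓑.metric.chronologicalFuture 𝓑.timeOrientation 𝓑.Mext) → (∀ p ∈ 𝓑.doc, 𝓑.killing p ≠ 0) → SimplyConnectedSpace 𝓑.doc → ∀ (U : Set 𝓑.carrier) (K : Π x : 𝓑.carrier, TangentSpace (𝓡 4) x), IsOpen U → 𝓑.horizon ⊆ U → IsConnected 𝓑.horizon → ContMDiffOn (𝓡 4) ((𝓡 4).prod 𝓘(ℝ, Literature.Geometry.Lorentzian.E4)) ((⊤ : ℕ∞) : WithTop ℕ∞) (fun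 x ↦ (Bundle.TotalSpace.mk' Literature.Geometry.Lorentzian.E4 x (K x) : TangentBundle (𝓡 4) 𝓑.carrier)) U → (∀ x ∈ U, ∀ v w : TangentSpace (𝓡 4) x, 𝓑.metric.val x (𝓑.metric.leviCivita K x v) w + 𝓑.metric.val x v (𝓑.metric.leviCivita K x w) = 0) → (∀ x ∈ U, VectorField.mlieBracket (𝓡 4) 𝓑.killing K x = 0) → (∀ p ∈ 𝓑.horizon, K p ≠ 0) → (∀ γ : ℝ → 𝓑.carrier, IsMIntegralCurve γ K → γ 0 ∈ 𝓑.horizon → ∀ t, γ t ∈ 𝓑.horizon) → (∀ x ∈ U ∩ 𝓑.doc, 𝓑.metric.val x (K x) (K x) < 0) →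
  ∃ κ : ℝ, κ ≠ 0 ∧ ∀ p ∈ 𝓑.horizon, 𝓑.metric.leviCivita K p (K p) = κ • K p

/-! Route-file-free version (imports only `Literature`), so that it elaborates while the farm olean of
`Theses.ZeroEnergyKerrOrBomb` is being rebuilt; the telescope binders of `DocAxisymmetryFromExtension` and
`CollarSurfaceGravityNeZero` are copied byte-for-byte from the crux decl `HawkingExtensionIsKerr` (rev 9). -/

end Summit.FinalStateConjecture.FinalStateConjecture.Cruxes.HawkingExtensionIsKerr.SketchIdeator2

end
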